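import Summits.QuantumFields.YangMills.Theorems.SlowBitWindowPolyakovSignWitness
import Summits.QuantumFields.YangMills.Theorems.SlowBitWindowInsertionTraceDefs
import Summits.QuantumFields.YangMills.Theorems.LuscherReductionRunningReductionTraceFormulaKernel
import Summits.QuantumFields.YangMills.Theorems.LuscherReductionRunningReductionTraceFormulaAveraging
import Summits.QuantumFields.YangMills.Theorems.LuscherReductionRunningReductionLatticeLinkKernel
import Summits.QuantumFields.YangMills.Theorems.FemtoTransferGapPositivityGram
import HarnessLib

/-!
# The one-step persistence bound along the closed chain of `2L` transfer kernels:
# `insTrace L β O 1 ≥ Z_phys(2L) − 2·insTrace L β 𝟙_A 0 − 2·e^{β(2|E| − t²/2)}·(e^{2β|E|})^{2L−1}`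

Support module for the trace-door cruxes `SlowBitWindow.StepPersistence` (stmt-QuantumFields-23271) and `SwapTwistDeficit.TwistDeficitLaplaceWindow`
(stmt-QuantumFields-23776, Laplace window W of LINE g11-A) of seat ym-idea-4.  The two-insertion trace `TT.insTrace L β O m` (p661692) is the closed chain of
`2L` bond kernels (`2L−1` copies of `K_β`, the seam `K_β^P`) with `O` inserted at slices `0` and `m`.  For the ONE-STEP slot `m = 1` we bound it from
below WITHOUT any spectral input, directly on the slice space:

* §1 the chain as a function on `Fin (2L) → GaugeConfig 3 L SU2`: measurable (`measurable_chain`), non-negative, bounded by `(e^{2β|E|})^{2L}`;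
  `insTrace L β 𝟙_A 0 = ∫ chain·𝟙_A(U₀)` (the un-normalised thermal weight of a slice event) and its monotonicity in `A`;
* §2 ★ `insTrace_one_ge_of_persistence`: if a measurable `O` with `|O| ≤ 1` satisfies the POINTWISE persistence inequality
  `O(U)O(V) ≥ 1 − 2·𝟙_A(U) − 2·𝟙[some link of (U,V) is t-far]` (e.g. the Polyakov sign witness of `…PolyakovSignWitness`, with `A` the strip of width
  `2Lt`), then `insTrace L β O 1 ≥ Z_phys(2L) − 2·insTrace L β 𝟙_A 0 − 2·e^{β(2|E|−t²/2)}(e^{2β|E|})^{2L−2}e^{2β|E|}`: a `t`-far link in the bond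
  `(U₀,U₁)` costs `e^{−βt²/2}` against the supremum of that bond, every other bond at most its supremum `e^{2β|E|}`.

HONEST FRAMING: fixed-lattice bookkeeping for a reduction (door); no semiclassics/RG; nothing about infinite volume, the continuum limit or the Clay gap.
No `sorry`, no new axiom, no new definition.  References: [cite: MadrasSokal1988, §2]; [cite: MontvayMunster1994, (3.145)]; [cite: SeilerLNP1982, §3].
-/

set_option autoImplicit false

noncomputable section

open MeasureTheory Filter Topology Real Function
open scoped Matrix ComplexConjugate BigOperators
open Literature.MathematicalPhysics.QuantumLattice
open Literature.MathematicalPhysics.QuantumFieldTheory hiding SU2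
open Summit.QuantumFields.YangMills.Theorems

namespace Summit.QuantumFields.YangMills.Theorems.FemtoTransferGap.TT

open Summit.QuantumFields.YangMills.Theorems.FemtoTransferGap

variable {L : ℕ} [NeZero L]

/-! ## §1 The closed chain of `2L` bond kernels: measurability, bounds, and the two traces it computes -/

/-- The physical average of a non-negative function is non-negative. [folklore] -/
theorem physAvg_nonneg {f : GaugeConfig 3 L SU2 → ℝ} (hf : ∀ U, 0 ≤ f U) (U : GaugeConfig 3 L SU2) : 0 ≤ physAvg f U := by
  unfold physAvg
  exact mul_nonneg (by norm_num) (Finset.sum_nonneg fun z _ => integral_nonneg fun g => hf _)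

/-- A bond kernel read on two slices of the slice space is measurable. [folklore] -/
theorem measurable_transferKernel_slices (β : ℝ) (n : ℕ) (i j : Fin (n + 1)) :
    Measurable fun Us : Fin (n + 1) → GaugeConfig 3 L SU2 => transferKernel su2Rep β (Us i) (Us j) := by
  have h1 : Measurable fun Us : Fin (n + 1) → GaugeConfig 3 L SU2 => (Us i, Us j) :=
    (measurable_pi_apply i).prodMk (measurable_pi_apply j)
  have h := (measurable_transferKernel_lat (L := L) β).comp h1
  simpa only [Function.comp_def] using h

/-- The physically averaged closing bond read on the last and first slices is measurable. [folklore] -/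
theorem measurable_physKernel_slices (β : ℝ) (n : ℕ) :
    Measurable fun Us : Fin (n + 1) → GaugeConfig 3 L SU2 => physKernel β (Us (Fin.last n)) (Us 0) := by
  have h1 : Measurable fun Us : Fin (n + 1) → GaugeConfig 3 L SU2 => (Us (Fin.last n), Us 0) :=
    (measurable_pi_apply _).prodMk (measurable_pi_apply 0)
  have h := (stronglyMeasurable_physKernel (L := L) β).measurable.comp h1
  simpa only [Function.comp_def, Function.uncurry_apply_pair] using h

/-- The closed chain `(∏_{i<2L-1} K_β(U_i,U_{i+1})) · K_β^P(U_{2L-1}, U_0)` is measurable on the slice space. [folklore] -/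
theorem measurable_chain (β : ℝ) :
    Measurable fun Us : Fin (2 * L - 1 + 1) → GaugeConfig 3 L SU2 =>
      (∏ i : Fin (2 * L - 1), transferKernel su2Rep β (Us i.castSucc) (Us i.succ)) *
        physAvg (transferKernel su2Rep β (Us (Fin.last (2 * L - 1)))) (Us 0) := by
  have hp : Measurable fun Us : Fin (2 * L - 1 + 1) → GaugeConfig 3 L SU2 =>
      ∏ i : Fin (2 * L - 1), transferKernel su2Rep β (Us i.castSucc) (Us i.succ) :=
    Finset.measurable_prod _ fun i _ => measurable_transferKernel_slices β (2 * L - 1) i.castSucc i.succ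
  exact hp.mul (measurable_physKernel_slices β (2 * L - 1))

/-- The closed chain is non-negative. [folklore] -/
theorem chain_nonneg (β : ℝ) (Us : Fin (2 * L - 1 + 1) → GaugeConfig 3 L SU2) :
    0 ≤ (∏ i : Fin (2 * L - 1), transferKernel su2Rep β (Us i.castSucc) (Us i.succ)) *
        physAvg (transferKernel su2Rep β (Us (Fin.last (2 * L - 1)))) (Us 0) :=
  mul_nonneg (Finset.prod_nonneg fun _ _ => (transferKernel_pos _ _ _ _).le) (physAvg_nonneg (fun V => (transferKernel_pos _ _ _ V).le) _)

/-- The closed chain is bounded by `(e^{2β|E|})^{2L-1} · e^{2β|E|}` (`β ≥ 0`). [folklore] -/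
theorem abs_chain_le {β : ℝ} (hβ : 0 ≤ β) (Us : Fin (2 * L - 1 + 1) → GaugeConfig 3 L SU2) :
    |(∏ i : Fin (2 * L - 1), transferKernel su2Rep β (Us i.castSucc) (Us i.succ)) *
        physAvg (transferKernel su2Rep β (Us (Fin.last (2 * L - 1)))) (Us 0)| ≤
      (Real.exp (2 * β) ^ Fintype.card (Edge 3 L)) ^ (2 * L - 1) * Real.exp (2 * β) ^ Fintype.card (Edge 3 L) := by
  set M : ℝ := Real.exp (2 * β) ^ Fintype.card (Edge 3 L) with hM
  have hKM : ∀ U V : GaugeConfig 3 L SU2, |transferKernel su2Rep β U V| ≤ M := fun U V => abs_transferKernel_le_lat hβ (U, V)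
  rw [abs_mul, Finset.abs_prod]
  refine mul_le_mul ?_ (abs_physAvg_le (fun V => hKM _ V) _) (abs_nonneg _) (by positivity)
  calc ∏ i : Fin (2 * L - 1), |transferKernel su2Rep β (Us i.castSucc) (Us i.succ)| ≤ ∏ _i : Fin (2 * L - 1), M :=
        Finset.prod_le_prod (fun i _ => abs_nonneg _) fun i _ => hKM _ _
    _ = M ^ (2 * L - 1) := by rw [Finset.prod_const, Finset.card_univ, Fintype.card_fin]

omit [NeZero L] in
/-- The one-step slot of `insTrace … 1` is the slice `1`. [folklore] -/
theorem fin_one_mod_eq (hL : 1 ≤ L) :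
    (⟨1 % (2 * L - 1 + 1), Nat.mod_lt _ (Nat.succ_pos _)⟩ : Fin (2 * L - 1 + 1)) = (⟨0, by omega⟩ : Fin (2 * L - 1)).succ := by
  apply Fin.ext
  simp only [Fin.val_succ]
  exact Nat.mod_eq_of_lt (by omega)

/-- `insTrace L β (𝟙_A) 0 = ∫ chain · 𝟙_A(U_0)` — the un-normalised thermal probability of the slice-`0` event `A`. [cite: MontvayMunster1994, (3.145)] -/
theorem insTrace_indicator_zero (β : ℝ) (A : Set (GaugeConfig 3 L SU2)) :
    insTrace L β (A.indicator fun _ => (1 : ℝ)) 0 =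
      ∫ Us : Fin (2 * L - 1 + 1) → GaugeConfig 3 L SU2,
        (∏ i : Fin (2 * L - 1), transferKernel su2Rep β (Us i.castSucc) (Us i.succ)) *
          physAvg (transferKernel su2Rep β (Us (Fin.last (2 * L - 1)))) (Us 0) * A.indicator (fun _ => (1 : ℝ)) (Us 0)
        ∂(Measure.pi fun _ : Fin (2 * L - 1 + 1) => configMeasure SU2 L) := by
  unfold insTrace
  refine integral_congr_ae (ae_of_all _ fun Us => ?_)
  have h0 : (⟨0 % (2 * L - 1 + 1), Nat.mod_lt _ (Nat.succ_pos _)⟩ : Fin (2 * L - 1 + 1)) = 0 := Fin.ext (Nat.zero_mod _)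
  dsimp only
  rw [h0]
  by_cases hU : Us 0 ∈ A
  · rw [Set.indicator_of_mem hU, mul_one]
  · rw [Set.indicator_of_notMem hU, mul_zero]

/-- Monotonicity of the slice-`0` thermal weight in the event. [folklore] -/
theorem insTrace_indicator_zero_mono {β : ℝ} (hβ : 0 ≤ β) {A B : Set (GaugeConfig 3 L SU2)} (hA : MeasurableSet A) (hB : MeasurableSet B)
    (hAB : A ⊆ B) : insTrace L β (A.indicator fun _ => (1 : ℝ)) 0 ≤ insTrace L β (B.indicator fun _ => (1 : ℝ)) 0 := by
  rw [insTrace_indicator_zero, insTrace_indicator_zero]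
  have hm := measurable_chain (L := L) β
  set C : ℝ := (Real.exp (2 * β) ^ Fintype.card (Edge 3 L)) ^ (2 * L - 1) * Real.exp (2 * β) ^ Fintype.card (Edge 3 L) with hC
  have hint : ∀ {S : Set (GaugeConfig 3 L SU2)}, MeasurableSet S → Integrable (fun Us : Fin (2 * L - 1 + 1) → GaugeConfig 3 L SU2 =>
      (∏ i : Fin (2 * L - 1), transferKernel su2Rep β (Us i.castSucc) (Us i.succ)) *
        physAvg (transferKernel su2Rep β (Us (Fin.last (2 * L - 1)))) (Us 0) * S.indicator (fun _ => (1 : ℝ)) (Us 0))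
      (Measure.pi fun _ : Fin (2 * L - 1 + 1) => configMeasure SU2 L) := fun {S} hS => by
    refine integrable_of_measurable_abs_le _ (hm.mul ((measurable_const.indicator hS).comp (measurable_pi_apply 0))) (C := C) fun Us => ?_
    have hind : |S.indicator (fun _ => (1 : ℝ)) (Us 0)| ≤ 1 := by
      by_cases hU : Us 0 ∈ S
      · rw [Set.indicator_of_mem hU, abs_one]
      · rw [Set.indicator_of_notMem hU, abs_zero]; exact zero_le_one
    calc |(∏ i : Fin (2 * L - 1), transferKernel su2Rep β (Us i.castSucc) (Us i.succ)) *
          physAvg (transferKernel su2Rep β (Us (Fin.last (2 * L - 1)))) (Us 0) * S.indicator (fun _ => (1 : ℝ)) (Us 0)|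
        = |(∏ i : Fin (2 * L - 1), transferKernel su2Rep β (Us i.castSucc) (Us i.succ)) *
          physAvg (transferKernel su2Rep β (Us (Fin.last (2 * L - 1)))) (Us 0)| * |S.indicator (fun _ => (1 : ℝ)) (Us 0)| := abs_mul _ _
      _ ≤ C * 1 := mul_le_mul (abs_chain_le hβ Us) hind (abs_nonneg _) (by positivity)
      _ = C := mul_one _
  refine integral_mono (hint hA) (hint hB) fun Us => ?_
  refine mul_le_mul_of_nonneg_left ?_ (chain_nonneg β Us)
  exact Set.indicator_le_indicator_of_subset hAB (fun _ => zero_le_one) _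

/-! ## §2 The one-step persistence bound along the chain -/

/-- ★ **Persistence bound along the chain.**  Let `O` be measurable with `|O| ≤ 1`, `A` a measurable slice event and `t ≥ 0`, and suppose the pointwise
persistence inequality `O(U)O(V) ≥ 1 − 2·𝟙_A(U) − 2·𝟙[∃ e, ‖U_e − V_e‖_F > t]`.  Then for `β ≥ 0`, `L ≥ 1`:
`insTrace L β O 1 ≥ Z_phys(2L) − 2·insTrace L β 𝟙_A 0 − 2·e^{β(2|E| − t²/2)}·(e^{2β|E|})^{2L−2}·e^{2β|E|}`
(the far event costs one exponentially small bond, every other bond at most its supremum). [cite: MadrasSokal1988, §2] [cite: SeilerLNP1982, §3] -/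
theorem insTrace_one_ge_of_persistence (hL : 1 ≤ L) {β : ℝ} (hβ : 0 ≤ β) {O : GaugeConfig 3 L SU2 → ℝ} (hOm : Measurable O)
    (hOb : ∀ U, |O U| ≤ 1) {A : Set (GaugeConfig 3 L SU2)} (hA : MeasurableSet A) {t : ℝ} (ht : 0 ≤ t)
    (hpt : ∀ U V : GaugeConfig 3 L SU2,
      1 - 2 * A.indicator (fun _ => (1 : ℝ)) U -
          2 * Set.indicator {p : GaugeConfig 3 L SU2 × GaugeConfig 3 L SU2 |
              ∃ e, t < frobNorm ((p.1 e : Matrix (Fin 2) (Fin 2) ℂ) - (p.2 e : Matrix (Fin 2) (Fin 2) ℂ))} (fun _ => (1 : ℝ)) (U, V) ≤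
        O U * O V) :
    physTrace L β (2 * L) - 2 * insTrace L β (A.indicator fun _ => (1 : ℝ)) 0 -
        2 * (Real.exp (β * (2 * (Fintype.card (Edge 3 L) : ℝ) - t ^ 2 / 2)) *
          (Real.exp (2 * β) ^ Fintype.card (Edge 3 L)) ^ (2 * L - 2) * Real.exp (2 * β) ^ Fintype.card (Edge 3 L)) ≤
      insTrace L β O 1 := by
  set E : ℕ := Fintype.card (Edge 3 L) with hE
  set M : ℝ := Real.exp (2 * β) ^ E with hM
  set η : ℝ := Real.exp (β * (2 * (E : ℝ) - t ^ 2 / 2)) with hη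
  set D : Set (GaugeConfig 3 L SU2 × GaugeConfig 3 L SU2) :=
    {p | ∃ e, t < frobNorm ((p.1 e : Matrix (Fin 2) (Fin 2) ℂ) - (p.2 e : Matrix (Fin 2) (Fin 2) ℂ))} with hDdef
  set μ : Measure (Fin (2 * L - 1 + 1) → GaugeConfig 3 L SU2) := Measure.pi fun _ => configMeasure SU2 L with hμ
  set F : (Fin (2 * L - 1 + 1) → GaugeConfig 3 L SU2) → ℝ := fun Us =>
    (∏ i : Fin (2 * L - 1), transferKernel su2Rep β (Us i.castSucc) (Us i.succ)) *
      physAvg (transferKernel su2Rep β (Us (Fin.last (2 * L - 1)))) (Us 0) with hF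
  have hFm : Measurable F := measurable_chain β
  have hF0 : ∀ Us, 0 ≤ F Us := chain_nonneg β
  have hFb : ∀ Us, |F Us| ≤ M ^ (2 * L - 1) * M := abs_chain_le hβ
  have hM0 : 0 ≤ M := by positivity
  have hKM : ∀ U V : GaugeConfig 3 L SU2, transferKernel su2Rep β U V ≤ M := fun U V =>
    (le_abs_self _).trans (abs_transferKernel_le_lat hβ (U, V))
  have hPM : ∀ U V : GaugeConfig 3 L SU2, physAvg (transferKernel su2Rep β U) V ≤ M := fun U V =>
    (le_abs_self _).trans (abs_physAvg_le (fun W => abs_transferKernel_le_lat hβ (U, W)) V)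
  -- the slot indices
  set i₀ : Fin (2 * L - 1) := ⟨0, by omega⟩ with hi₀
  have hcast : i₀.castSucc = (0 : Fin (2 * L - 1 + 1)) := Fin.ext rfl
  have hslot : (⟨1 % (2 * L - 1 + 1), Nat.mod_lt _ (Nat.succ_pos _)⟩ : Fin (2 * L - 1 + 1)) = i₀.succ := fin_one_mod_eq hL
  -- (a) the far event costs `η M^{2L-2} M` pointwise
  have hfar : ∀ Us, F Us * D.indicator (fun _ => (1 : ℝ)) (Us 0, Us i₀.succ) ≤ η * M ^ (2 * L - 2) * M := by
    intro Us
    have hsplit : (∏ i : Fin (2 * L - 1), transferKernel su2Rep β (Us i.castSucc) (Us i.succ)) =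
        transferKernel su2Rep β (Us 0) (Us i₀.succ) *
          ∏ i ∈ Finset.univ.erase i₀, transferKernel su2Rep β (Us i.castSucc) (Us i.succ) := by
      rw [← Finset.mul_prod_erase Finset.univ _ (Finset.mem_univ i₀), hcast]
    have hrest : ∏ i ∈ Finset.univ.erase i₀, transferKernel su2Rep β (Us i.castSucc) (Us i.succ) ≤ M ^ (2 * L - 2) := by
      calc ∏ i ∈ Finset.univ.erase i₀, transferKernel su2Rep β (Us i.castSucc) (Us i.succ) ≤ ∏ _i ∈ Finset.univ.erase i₀, M :=
            Finset.prod_le_prod (fun i _ => (transferKernel_pos _ _ _ _).le) fun i _ => hKM _ _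
        _ = M ^ (2 * L - 2) := by
            rw [Finset.prod_const, Finset.card_erase_of_mem (Finset.mem_univ _), Finset.card_univ, Fintype.card_fin,
              show 2 * L - 1 - 1 = 2 * L - 2 by omega]
    have hrest0 : 0 ≤ ∏ i ∈ Finset.univ.erase i₀, transferKernel su2Rep β (Us i.castSucc) (Us i.succ) :=
      Finset.prod_nonneg fun i _ => (transferKernel_pos _ _ _ _).le
    have hKD : transferKernel su2Rep β (Us 0) (Us i₀.succ) * D.indicator (fun _ => (1 : ℝ)) (Us 0, Us i₀.succ) ≤ η := by
      simpa only [hDdef, hη, hE] using FlatSheet.transferKernel_mul_indicator_far_le hβ ht (Us 0) (Us i₀.succ)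
    have hP0 : 0 ≤ physAvg (transferKernel su2Rep β (Us (Fin.last (2 * L - 1)))) (Us 0) :=
      physAvg_nonneg (fun V => (transferKernel_pos _ _ _ V).le) _
    have hD0 : 0 ≤ D.indicator (fun _ => (1 : ℝ)) (Us 0, Us i₀.succ) := Set.indicator_nonneg (fun _ _ => zero_le_one) _
    calc F Us * D.indicator (fun _ => (1 : ℝ)) (Us 0, Us i₀.succ)
        = (transferKernel su2Rep β (Us 0) (Us i₀.succ) * D.indicator (fun _ => (1 : ℝ)) (Us 0, Us i₀.succ)) *
            (∏ i ∈ Finset.univ.erase i₀, transferKernel su2Rep β (Us i.castSucc) (Us i.succ)) *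
            physAvg (transferKernel su2Rep β (Us (Fin.last (2 * L - 1)))) (Us 0) := by
          simp only [hF]; rw [hsplit]; ring
      _ ≤ η * M ^ (2 * L - 2) * M := by
          refine mul_le_mul (mul_le_mul hKD hrest hrest0 (Real.exp_pos _).le) (hPM _ _) hP0 (by positivity)
  -- (b) pointwise: `F·(O₀O₁) ≥ F − 2F·𝟙_A(U₀) − 2ηM^{2L-2}M`
  have hpoint : ∀ Us, F Us - 2 * (F Us * A.indicator (fun _ => (1 : ℝ)) (Us 0)) - 2 * (η * M ^ (2 * L - 2) * M) ≤
      F Us * (O (Us 0) * O (Us ⟨1 % (2 * L - 1 + 1), Nat.mod_lt _ (Nat.succ_pos _)⟩)) := by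
    intro Us
    rw [hslot]
    have h1 := mul_le_mul_of_nonneg_left (hpt (Us 0) (Us i₀.succ)) (hF0 Us)
    have h2 := hfar Us
    nlinarith [h1, h2]
  -- (c) integrate
  have hIF : Integrable F μ := integrable_of_measurable_abs_le _ hFm hFb
  have hIA : Integrable (fun Us => F Us * A.indicator (fun _ => (1 : ℝ)) (Us 0)) μ := by
    refine integrable_of_measurable_abs_le _ (hFm.mul ((measurable_const.indicator hA).comp (measurable_pi_apply 0))) (C := M ^ (2 * L - 1) * M) fun Us => ?_
    have hind : |A.indicator (fun _ => (1 : ℝ)) (Us 0)| ≤ 1 := by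
      by_cases hU : Us 0 ∈ A
      · rw [Set.indicator_of_mem hU, abs_one]
      · rw [Set.indicator_of_notMem hU, abs_zero]; exact zero_le_one
    calc |F Us * A.indicator (fun _ => (1 : ℝ)) (Us 0)| = |F Us| * |A.indicator (fun _ => (1 : ℝ)) (Us 0)| := abs_mul _ _
      _ ≤ M ^ (2 * L - 1) * M * 1 := mul_le_mul (hFb Us) hind (abs_nonneg _) (by positivity)
      _ = M ^ (2 * L - 1) * M := mul_one _
  have hIO : Integrable (fun Us => F Us * (O (Us 0) * O (Us ⟨1 % (2 * L - 1 + 1), Nat.mod_lt _ (Nat.succ_pos _)⟩))) μ := by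
    refine integrable_of_measurable_abs_le _ (hFm.mul ((hOm.comp (measurable_pi_apply 0)).mul (hOm.comp (measurable_pi_apply _))))
      (C := M ^ (2 * L - 1) * M) fun Us => ?_
    have hO1 := hOb (Us 0)
    have hO2 := hOb (Us ⟨1 % (2 * L - 1 + 1), Nat.mod_lt _ (Nat.succ_pos _)⟩)
    have hOO : |O (Us 0) * O (Us ⟨1 % (2 * L - 1 + 1), Nat.mod_lt _ (Nat.succ_pos _)⟩)| ≤ 1 := by
      rw [abs_mul]; exact mul_le_one₀ hO1 (abs_nonneg _) hO2
    calc |F Us * (O (Us 0) * O (Us ⟨1 % (2 * L - 1 + 1), Nat.mod_lt _ (Nat.succ_pos _)⟩))|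
        = |F Us| * |O (Us 0) * O (Us ⟨1 % (2 * L - 1 + 1), Nat.mod_lt _ (Nat.succ_pos _)⟩)| := abs_mul _ _
      _ ≤ M ^ (2 * L - 1) * M * 1 := mul_le_mul (hFb Us) hOO (abs_nonneg _) (by positivity)
      _ = M ^ (2 * L - 1) * M := mul_one _
  haveI : IsProbabilityMeasure μ := by rw [hμ]; infer_instance
  have h12 : Integrable (fun Us => F Us - 2 * (F Us * A.indicator (fun _ => (1 : ℝ)) (Us 0))) μ := hIF.sub (hIA.const_mul 2)
  have h3 : Integrable (fun _ : Fin (2 * L - 1 + 1) → GaugeConfig 3 L SU2 => 2 * (η * M ^ (2 * L - 2) * M)) μ := integrable_const _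
  have h123 : Integrable (fun Us => F Us - 2 * (F Us * A.indicator (fun _ => (1 : ℝ)) (Us 0)) - 2 * (η * M ^ (2 * L - 2) * M)) μ := h12.sub h3
  have hint := integral_mono h123 hIO hpoint
  rw [integral_sub h12 h3, integral_sub hIF (hIA.const_mul 2), integral_const_mul, integral_const, smul_eq_mul, probReal_univ,
    one_mul] at hint
  -- identify the three integrals
  have hZ : physTrace L β (2 * L) = ∫ Us, F Us ∂μ := by
    simp only [physTrace, physTraceSucc, hF, hμ]
  have hS : insTrace L β (A.indicator fun _ => (1 : ℝ)) 0 = ∫ Us, F Us * A.indicator (fun _ => (1 : ℝ)) (Us 0) ∂μ :=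
    insTrace_indicator_zero β A
  have hI : insTrace L β O 1 = ∫ Us, F Us * (O (Us 0) * O (Us ⟨1 % (2 * L - 1 + 1), Nat.mod_lt _ (Nat.succ_pos _)⟩)) ∂μ := by
    simp only [insTrace, hF, hμ]
  rw [hZ, hS, hI]
  simpa only [hη, hM, hE] using hint

end Summit.QuantumFields.YangMills.Theorems.FemtoTransferGap.TT

end
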